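import Summits.AtomisticToContinuum.Crystallization.Theorems.PalmUnimodularRigidityLayeredLawsSelectHcpReRoot

/-!
# Crux `LayeredLawsSelectHcp` (stmt-AtomisticToContinuum-9226), line `mtp-prestress-split-ergodic-frame`:
# the re-rooting involution behind the zero mean of directed correctors

Registered sub-goal `tube_reRoot_involution` of the crux item (lead c2, cycle 3; the combinatorial core of `stub_correctorMeanZero`).
The mean of a directed orbit-sum corrector `∑_{X ∈ RC(S)} (φ (reRoot X c) − φ X)` vanishes because, under the Mecke identity with the
transport function `g(μ, y) = ∑_{X ∈ RC(S), X c = y} φ (reRoot X c)`, the received mass at the root is `∑_{y ∈ S} ∑_{Ψ ∈ RC(S − y), Ψ c = −y}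
φ (reRoot Ψ c)`, and `(y, Ψ) ↦ reRoot Ψ c` is a BIJECTION onto `RC(S)` with inverse `X ↦ (X ĉ, reRoot X ĉ)`, `ĉ = −c` on even layers,
`ĉ = c` on odd layers (`labelShift ĉ` is the inverse index map of `labelShift c`).  This file proves the index-level and chart-level
involution identities: `labelShift ĉ (labelShift c u) = u`, `labelShift c (labelShift ĉ u) = u`, `reRoot (reRoot X ĉ) c = X` (for
`X 0 = 0`), `(reRoot X ĉ) c = −X ĉ`, and that `reRoot X ĉ` is a rooted chart of `S − X ĉ` (landed `tube_reRoot_isRootedChart`).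
[folklore]
-/

noncomputable section

namespace Summit.AtomisticToContinuum.Crystallization.Theorems.PalmUnimodularRigidity.LayeredLawsSelectHcp

open MeasureTheory Set
open Literature.MathematicalPhysics.StatisticalMechanics Literature.Geometry.DiscreteGeometry

/-- The inverse index map of `labelShift c` is `labelShift ĉ` with `ĉ = −c` (even layer) / `ĉ = c` (odd layer): left inverse. [folklore] -/
theorem labelShift_inv_left (c u : ℤ × ℤ × ℤ) :
    labelShift (if Even c.1 then -c else c) (labelShift c u) = u := by
  unfold labelShift
  by_cases hc : Even c.1
  · have hnc : Even (-c).1 := by simpa using hc.neg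
    simp only [hc, hnc, if_true]; abel
  · simp [hc]

/-- The inverse index map of `labelShift c` is `labelShift ĉ`: right inverse. [folklore] -/
theorem labelShift_inv_right (c u : ℤ × ℤ × ℤ) :
    labelShift c (labelShift (if Even c.1 then -c else c) u) = u := by
  unfold labelShift
  by_cases hc : Even c.1
  · have hnc : Even (-c).1 := by simpa using hc.neg
    simp only [hc, hnc, if_true]; abel
  · simp [hc]

/-- `labelShift ĉ 0 = ĉ` and `labelShift c ĉ… `: the label `ĉ` is sent to the root by `labelShift c`: `labelShift c ĉ'`-form used below,
namely `labelShift ĉ c = 0`. [folklore] -/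
theorem labelShift_inv_apply_self (c : ℤ × ℤ × ℤ) :
    labelShift (if Even c.1 then -c else c) c = 0 := by
  have h := labelShift_inv_left c 0
  rwa [labelShift_zero] at h

/-- **Registered sub-goal `tube_reRoot_involution`.**  Re-rooting at `ĉ` and then at `c` returns the chart: for `X 0 = 0`,
`reRoot (reRoot X ĉ) c = X` with `ĉ = if Even c.1 then −c else c`. [folklore] -/
theorem tube_reRoot_involution :
    ∀ X : ℤ × ℤ × ℤ → EuclideanSpace ℝ (Fin 3), X 0 = 0 → ∀ c : ℤ × ℤ × ℤ,
      reRoot (reRoot X (if Even c.1 then -c else c)) c = X := by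
  intro X hX0 c
  funext u
  simp only [reRoot]
  rw [labelShift_inv_left, labelShift_inv_apply_self, hX0, zero_sub, sub_neg_eq_add, sub_add_cancel]

/-- The chart re-rooted at `ĉ` sends the label `c` to minus the old position of `ĉ`: `(reRoot X ĉ) c = −X ĉ` (for `X 0 = 0`) — i.e. in
the re-rooted configuration `S − X ĉ` the OLD ROOT sits at label `c`. [folklore] -/
theorem reRoot_inv_apply (X : ℤ × ℤ × ℤ → EuclideanSpace ℝ (Fin 3)) (hX0 : X 0 = 0) (c : ℤ × ℤ × ℤ) :
    reRoot X (if Even c.1 then -c else c) c = -X (if Even c.1 then -c else c) := by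
  simp only [reRoot]
  rw [labelShift_inv_apply_self, hX0, zero_sub]

/-- Conversely, re-rooting at `c` and then at `ĉ`... in the form needed for injectivity of `(y, Ψ) ↦ reRoot Ψ c`: if `Ψ 0 = 0` then
`reRoot (reRoot Ψ c) ĉ = Ψ`, `ĉ = if Even c.1 then −c else c` (note `Even ĉ.1 ↔ Even c.1`). [folklore] -/
theorem reRoot_involution' (Ψ : ℤ × ℤ × ℤ → EuclideanSpace ℝ (Fin 3)) (hΨ0 : Ψ 0 = 0) (c : ℤ × ℤ × ℤ) :
    reRoot (reRoot Ψ c) (if Even c.1 then -c else c) = Ψ := by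
  funext u
  simp only [reRoot]
  have h1 : labelShift c (labelShift (if Even c.1 then -c else c) u) = u := labelShift_inv_right c u
  have h2 : labelShift c (if Even c.1 then -c else c) = 0 := by
    have := labelShift_inv_right c 0
    rwa [labelShift_zero] at this
  rw [h1, h2, hΨ0, zero_sub, sub_neg_eq_add, sub_add_cancel]

end Summit.AtomisticToContinuum.Crystallization.Theorems.PalmUnimodularRigidity.LayeredLawsSelectHcp

end
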